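import Mathlib
import Literature.Analysis.FluidPDE.MollifiedEulerConeEuclidean
import Literature.Analysis.FluidPDE.ExteriorDeRham
import Literature.Analysis.FluidPDE.PressureReconstruction
import HarnessLib

/-!
# The translation-mollified weak Euler cone has a smooth pressure off the ball

Analysis/FluidPDE support file, capstone of `MollifiedEulerCone(Euclidean)` (tool T1) and
`ExteriorDeRham` (tool T2) for the free-space sink completion (route PointSink of the
anomalous-dissipation summit, stub `stub_freeSpaceSinkCompletion`). Let `V : ℝ³ → ℝ³` be
measurable with `|V|² ∈ L¹_loc(ℝ³)` and a PRESSURE-FREE WEAK STEADY EULER FIELD OFF THE ORIGIN,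
and `ρ ∈ C_c^∞` a kernel with `support ρ ⊆ B_δ`; `S = ρ ⋆ (V ⊗ V)` is the mollified momentum
flux, `Sᵢⱼ = ρ ⋆ (VᵢVⱼ)`.

* `contDiff_divFlux` — the row-divergence `div S = ∑ᵢ (∑ⱼ ∂ⱼSᵢⱼ) eᵢ` is smooth;
* `integral_inner_divFlux_eq_zero` — `∫ ⟪div S, φ⟫ = 0` for every smooth divergence-free `φ`
  compactly supported in `{δ < ‖x‖}` (entrywise integration by parts
  `integral_fderiv_apply_mul_eq_neg`, then the stress pairing
  `integral_sum_sum_mollifiedFlux_mul_eq_zero` of T1);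
* `exists_mollified_pressure` — **there is a smooth pressure `P` on `{4δ < ‖x‖}` with
  `∇P = -div S`**, i.e. `∂ⱼSᵢⱼ + ∂ᵢP = 0` classically there (T2:
  `ExteriorDeRham.exists_potential_of_forall_integral_inner_eq_zero`). Together with
  `divergence_convolution_velocity_eq_zero` (`div (ρ ⋆ V) = 0`) and `posSemidef_mollified_defect`
  (`S - (ρ ⋆ V) ⊗ (ρ ⋆ V) ⪰ 0`) this makes `(ρ ⋆ V, S + P·Id)` a SMOOTH STEADY EULER–REYNOLDS
  SUBSOLUTION WITHOUT FORCE on `{4δ < ‖x‖}` — one layer of the mollifier ladder; the ladder's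
  remaining steps (gluing layers of different `δ` by compactly supported symmetric
  anti-divergence with negative-order bounds, and the `L¹` bookkeeping) are not in this file.

## Mathlib / tree search

Everything is assembled from the tree: `MollifiedEulerConeEuclidean` (T1), `ExteriorDeRham` (T2),
`PressureReconstruction.integral_fderiv_apply_mul_eq_neg` (IBP against a test function); Mathlib:
`EuclideanSpace.inner_single_left`, `ContDiff.fderiv_right`, `integral_finsetSum`. No definitions,
no named facts, no duplicates (searched `mollified_pressure\|divFlux`, 2026-08-17).

## References

* C. De Lellis, L. Székelyhidi Jr., Arch. Ration. Mech. Anal. 195 (2010) 225–260, §2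
  (subsolutions).
* G. P. Galdi, *An Introduction to the Mathematical Theory of the Navier–Stokes Equations*
  (2011), Lemma III.1.1 (the pressure of a field orthogonal to solenoidal tests).
-/

noncomputable section

open MeasureTheory Filter Topology Set Metric Function ContinuousLinearMap
open scoped RealInnerProductSpace ContDiff Convolution

namespace Literature.Analysis.FluidPDE

namespace MollifiedEulerCone

variable {V : EuclideanSpace ℝ (Fin 3) → EuclideanSpace ℝ (Fin 3)} {ρ : EuclideanSpace ℝ (Fin 3) → ℝ}

/-- The partial derivatives of the mollified flux entries are smooth. [folklore] -/
theorem contDiff_fderiv_flux_apply (hVm : AEStronglyMeasurable V volume)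
    (hV2 : LocallyIntegrable (fun x => ‖V x‖ ^ 2) volume) (hρ : ContDiff ℝ ∞ ρ)
    (hρc : HasCompactSupport ρ) (i j : Fin 3) (e : EuclideanSpace ℝ (Fin 3)) :
    ContDiff ℝ ∞ fun x =>
      fderiv ℝ (ρ ⋆[lsmul ℝ ℝ, volume] fun y => V y i * V y j) x e :=
  ((contDiff_convolution_flux hVm hV2 hρ hρc i j).fderiv_right (m := ∞) le_rfl).clm_apply
    contDiff_const

/-- **The row-divergence of the mollified flux is smooth**:
`x ↦ ∑ᵢ (∑ⱼ ∂ⱼ Sᵢⱼ(x)) eᵢ ∈ C^∞`. [folklore] -/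
theorem contDiff_divFlux (hVm : AEStronglyMeasurable V volume)
    (hV2 : LocallyIntegrable (fun x => ‖V x‖ ^ 2) volume) (hρ : ContDiff ℝ ∞ ρ)
    (hρc : HasCompactSupport ρ) :
    ContDiff ℝ ∞ fun x : EuclideanSpace ℝ (Fin 3) => ∑ i : Fin 3, (∑ j : Fin 3,
      fderiv ℝ (ρ ⋆[lsmul ℝ ℝ, volume] fun y => V y i * V y j) x
        (EuclideanSpace.single j 1)) • (EuclideanSpace.single i (1 : ℝ)) :=
  ContDiff.sum fun i _ => (ContDiff.sum fun j _ =>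
    contDiff_fderiv_flux_apply hVm hV2 hρ hρc i j _).smul contDiff_const

/-- Coordinates of the derivative of a vector field: `(Dφ(x) e)ᵢ = D(φᵢ)(x) e`. [folklore] -/
theorem fderiv_apply_coord {φ : EuclideanSpace ℝ (Fin 3) → EuclideanSpace ℝ (Fin 3)}
    (hφ : Differentiable ℝ φ) (x e : EuclideanSpace ℝ (Fin 3)) (i : Fin 3) :
    fderiv ℝ (fun y => φ y i) x e = fderiv ℝ φ x e i := by
  have h := ((EuclideanSpace.proj i : EuclideanSpace ℝ (Fin 3) →L[ℝ] ℝ).hasFDerivAt.comp x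
    (hφ x).hasFDerivAt).fderiv
  have h' : (fun y => φ y i) = (EuclideanSpace.proj i : EuclideanSpace ℝ (Fin 3) →L[ℝ] ℝ) ∘ φ :=
    rfl
  rw [h', h]
  rfl

/-- **The row-divergence of the mollified flux is orthogonal to solenoidal tests off the ball.**
With `Sᵢⱼ = ρ ⋆ (VᵢVⱼ)` (`V` pressure-free weak Euler off the origin, `|V|² ∈ L¹_loc`,
`support ρ ⊆ B_δ`, `ρ ∈ C_c^∞`): `∫ ⟪∑ᵢ (∑ⱼ ∂ⱼSᵢⱼ) eᵢ, φ⟫ = 0` for every smooth divergence-free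
`φ` compactly supported in `{δ < ‖x‖}` (integrate by parts entrywise, then
`integral_sum_sum_mollifiedFlux_mul_eq_zero`). [folklore] -/
theorem integral_inner_divFlux_eq_zero (hVm : AEStronglyMeasurable V volume)
    (hV2 : LocallyIntegrable (fun x => ‖V x‖ ^ 2) volume)
    (hEuler : ∀ φ : EuclideanSpace ℝ (Fin 3) → EuclideanSpace ℝ (Fin 3),
      FunctionSpaces.IsTestFunctionOn ⟨{x : EuclideanSpace ℝ (Fin 3) | x ≠ 0}, isOpen_ne⟩ φ →
      (∀ x, VectorCalculus.divergence φ x = 0) → ∫ x, ⟪V x, fderiv ℝ φ x (V x)⟫ = 0)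
    (hρ : ContDiff ℝ ∞ ρ) {δ : ℝ} (hρδ : support ρ ⊆ ball (0 : EuclideanSpace ℝ (Fin 3)) δ)
    {φ : EuclideanSpace ℝ (Fin 3) → EuclideanSpace ℝ (Fin 3)}
    (hφ : FunctionSpaces.IsTestFunctionOn
      ⟨{x : EuclideanSpace ℝ (Fin 3) | δ < ‖x‖}, isOpen_lt continuous_const continuous_norm⟩ φ)
    (hdiv : ∀ x, VectorCalculus.divergence φ x = 0) :
    ∫ x, ⟪∑ i : Fin 3, (∑ j : Fin 3,
      fderiv ℝ (ρ ⋆[lsmul ℝ ℝ, volume] fun y => V y i * V y j) x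
        (EuclideanSpace.single j 1)) • (EuclideanSpace.single i (1 : ℝ)), φ x⟫ = 0 := by
  have hρc : HasCompactSupport ρ := hasCompactSupport_of_support_subset_ball hρδ
  set S : Fin 3 → Fin 3 → EuclideanSpace ℝ (Fin 3) → ℝ := fun i j =>
    ρ ⋆[lsmul ℝ ℝ, volume] fun y => V y i * V y j with hS
  change ∫ x, ⟪∑ i : Fin 3, (∑ j : Fin 3, fderiv ℝ (S i j) x (EuclideanSpace.single j 1)) •
      (EuclideanSpace.single i (1 : ℝ)), φ x⟫ = 0
  have hSs : ∀ i j, ContDiff ℝ ∞ (S i j) := fun i j => contDiff_convolution_flux hVm hV2 hρ hρc i j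
  have hS1 : ∀ i j, ContDiff ℝ 1 (S i j) := fun i j => (hSs i j).of_le (by exact_mod_cast le_top)
  have hφd : Differentiable ℝ φ := hφ.contDiff.differentiable (by simp)
  -- the components of the test field
  have hφi : ∀ i, ContDiff ℝ ∞ (fun y => φ y i) := fun i =>
    (EuclideanSpace.proj i : EuclideanSpace ℝ (Fin 3) →L[ℝ] ℝ).contDiff.comp hφ.contDiff
  have hφic : ∀ i, HasCompactSupport (fun y => φ y i) := fun i =>
    hφ.hasCompactSupport.comp_left (g := fun v : EuclideanSpace ℝ (Fin 3) => v i) rfl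
  -- expand the inner product
  have hexp : ∀ x, ⟪∑ i : Fin 3, (∑ j : Fin 3, fderiv ℝ (S i j) x (EuclideanSpace.single j 1)) •
      (EuclideanSpace.single i (1 : ℝ)), φ x⟫ =
      ∑ i, ∑ j, fderiv ℝ (S i j) x (EuclideanSpace.single j 1) * φ x i := by
    intro x
    rw [sum_inner]
    refine Finset.sum_congr rfl fun i _ => ?_
    rw [real_inner_smul_left, EuclideanSpace.inner_single_left, map_one, one_mul, Finset.sum_mul]
  simp_rw [hexp]
  -- integrability of each term
  have hint : ∀ i j, Integrable (fun x => fderiv ℝ (S i j) x (EuclideanSpace.single j 1) * φ x i) :=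
    fun i j => ((((hSs i j).continuous_fderiv (by simp)).clm_apply continuous_const).mul
      (hφi i).continuous).integrable_of_hasCompactSupport (hφic i).mul_left
  rw [integral_finsetSum _ fun i _ => integrable_finsetSum _ fun j _ => hint i j]
  simp_rw [integral_finsetSum _ fun j _ => hint _ j]
  -- integrate by parts entrywise: `∫ (∂ⱼSᵢⱼ) φᵢ = -∫ Sᵢⱼ ∂ⱼφᵢ`
  have hibp : ∀ i j, ∫ x, fderiv ℝ (S i j) x (EuclideanSpace.single j 1) * φ x i =
      -∫ x, S i j x * fderiv ℝ φ x (EuclideanSpace.single j 1) i := by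
    intro i j
    have h := integral_fderiv_apply_mul_eq_neg (hφi i) (hφic i) (hS1 i j)
      (EuclideanSpace.single j 1)
    -- h : ∫ D(φᵢ) eⱼ * Sᵢⱼ = -∫ φᵢ * DSᵢⱼ eⱼ
    simp_rw [fderiv_apply_coord hφd] at h
    have h1 : ∫ x, fderiv ℝ (S i j) x (EuclideanSpace.single j 1) * φ x i =
        ∫ x, φ x i * fderiv ℝ (S i j) x (EuclideanSpace.single j 1) :=
      integral_congr_ae (Eventually.of_forall fun x => mul_comm _ _)
    have h2 : ∫ x, S i j x * fderiv ℝ φ x (EuclideanSpace.single j 1) i =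
        ∫ x, fderiv ℝ φ x (EuclideanSpace.single j 1) i * S i j x :=
      integral_congr_ae (Eventually.of_forall fun x => mul_comm _ _)
    rw [h1, h2]
    linarith
  simp_rw [hibp]
  rw [show (∑ i : Fin 3, ∑ j : Fin 3, -∫ x, S i j x * fderiv ℝ φ x (EuclideanSpace.single j 1) i) =
      -∑ i : Fin 3, ∑ j : Fin 3, ∫ x, S i j x * fderiv ℝ φ x (EuclideanSpace.single j 1) i by
    simp [Finset.sum_neg_distrib]]
  rw [neg_eq_zero]
  -- reassemble into the stress pairing of `integral_sum_sum_mollifiedFlux_mul_eq_zero`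
  have hint2 : ∀ i j, Integrable (fun x => S i j x * fderiv ℝ φ x (EuclideanSpace.single j 1) i) :=
    fun i j => by
      have hc : Continuous fun x => fderiv ℝ φ x (EuclideanSpace.single j 1) i :=
        (EuclideanSpace.proj i : EuclideanSpace ℝ (Fin 3) →L[ℝ] ℝ).continuous.comp
          ((hφ.contDiff.continuous_fderiv (by simp)).clm_apply continuous_const)
      refine ((hSs i j).continuous.mul hc).integrable_of_hasCompactSupport ?_
      exact ((hφ.hasCompactSupport.fderiv_apply (𝕜 := ℝ) (EuclideanSpace.single j 1)).comp_left
        (g := fun v : EuclideanSpace ℝ (Fin 3) => v i) rfl).mul_left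
  have h0 := integral_sum_sum_mollifiedFlux_mul_eq_zero hVm hV2 hEuler hρ.continuous hρδ hφ hdiv
  have h0' : ∫ x, ∑ i : Fin 3, ∑ j : Fin 3,
      S i j x * fderiv ℝ φ x (EuclideanSpace.single j 1) i = 0 := by
    rw [← h0]
    refine integral_congr_ae (Eventually.of_forall fun x => ?_)
    refine Finset.sum_congr rfl fun i _ => Finset.sum_congr rfl fun j _ => ?_
    rw [← convolution_flux_apply x i j]
  rw [integral_finsetSum _ (fun i _ => integrable_finsetSum _ fun j _ => hint2 i j)] at h0'
  have hsw : ∀ i : Fin 3, ∫ x, ∑ j : Fin 3, S i j x * fderiv ℝ φ x (EuclideanSpace.single j 1) i =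
      ∑ j : Fin 3, ∫ x, S i j x * fderiv ℝ φ x (EuclideanSpace.single j 1) i := fun i =>
    integral_finsetSum _ fun j _ => hint2 i j
  simp_rw [hsw] at h0'
  exact h0'

/-- **The translation-mollified weak Euler cone has a smooth pressure off the ball.** For `V`
measurable with `|V|² ∈ L¹_loc(ℝ³)`, pressure-free weak Euler off the origin, and a smooth
kernel `ρ` with `support ρ ⊆ B_δ`, the mollified flux `S = ρ ⋆ (V ⊗ V)` admits a smooth pressure
`P` on `{4δ < ‖x‖}`: `∇P = -div S` there, i.e. `∂ⱼSᵢⱼ + ∂ᵢP = 0` classically — the pair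
`(ρ ⋆ V, S + P·Id)` is a smooth divergence-free velocity with a smooth divergence-free symmetric
stress off `B̄_{4δ}`, and `S - (ρ ⋆ V) ⊗ (ρ ⋆ V) ⪰ 0` (`posSemidef_mollified_defect`): a smooth
Euler–Reynolds subsolution layer of the free-space sink completion. Proof:
`integral_inner_divFlux_eq_zero` + `ExteriorDeRham.exists_potential_of_forall_integral_inner_eq_zero`.
[folklore] -/
theorem exists_mollified_pressure (hVm : AEStronglyMeasurable V volume)
    (hV2 : LocallyIntegrable (fun x => ‖V x‖ ^ 2) volume)
    (hEuler : ∀ φ : EuclideanSpace ℝ (Fin 3) → EuclideanSpace ℝ (Fin 3),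
      FunctionSpaces.IsTestFunctionOn ⟨{x : EuclideanSpace ℝ (Fin 3) | x ≠ 0}, isOpen_ne⟩ φ →
      (∀ x, VectorCalculus.divergence φ x = 0) → ∫ x, ⟪V x, fderiv ℝ φ x (V x)⟫ = 0)
    (hρ : ContDiff ℝ ∞ ρ) {δ : ℝ} (hρδ : support ρ ⊆ ball (0 : EuclideanSpace ℝ (Fin 3)) δ) :
    ∃ P : EuclideanSpace ℝ (Fin 3) → ℝ,
      ContDiffOn ℝ ∞ P {x : EuclideanSpace ℝ (Fin 3) | 4 * δ < ‖x‖} ∧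
      ∀ x : EuclideanSpace ℝ (Fin 3), 4 * δ < ‖x‖ →
        HasGradientAt P (-(∑ i : Fin 3, (∑ j : Fin 3,
          fderiv ℝ (ρ ⋆[lsmul ℝ ℝ, volume] fun y => V y i * V y j) x
            (EuclideanSpace.single j 1)) • (EuclideanSpace.single i (1 : ℝ)))) x := by
  have hρc : HasCompactSupport ρ := hasCompactSupport_of_support_subset_ball hρδ
  have hg : ContDiff ℝ ∞ fun x : EuclideanSpace ℝ (Fin 3) => -(∑ i : Fin 3, (∑ j : Fin 3,
      fderiv ℝ (ρ ⋆[lsmul ℝ ℝ, volume] fun y => V y i * V y j) x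
        (EuclideanSpace.single j 1)) • (EuclideanSpace.single i (1 : ℝ))) :=
    (contDiff_divFlux hVm hV2 hρ hρc).neg
  refine ExteriorDeRham.exists_potential_of_forall_integral_inner_eq_zero hg
    (fun φ hφ hdiv => ?_)
  simp_rw [inner_neg_left]
  rw [integral_neg, integral_inner_divFlux_eq_zero hVm hV2 hEuler hρ hρδ hφ hdiv, neg_zero]

end MollifiedEulerCone

end Literature.Analysis.FluidPDE

end
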